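import Literature.RingTheory.HilbertSamuel.DirectrixLocal
import HarnessLib

/-!
# [OURS · L1 W4.2] The directrix dimension under a LINEAR SECTION of the ambient space: pushing an ideal forward along a
# graded substitution `K[X_1, …, X_n] → K[Y_1, …, Y_m]` (linear forms ↦ linear forms) loses at most `n − m` directrix
# dimensions — Dietel's (6.4.6) for the directrix, the tool behind «cutting a cone by a hyperplane costs at most one ridge /
# directrix dimension» (campaign s42, cell res-hironaka; informal crux `RidgeConfinement`, stmt-ResolutionOfSingularities-17845;
# `--supports`; brick B2 of the unconditional `RidgeDimMonotone`)

HONEST FRAMING. OURS (slot W4.2, prover res-L1-s42-pv-1, gen 5). Elementary linear algebra over the tree's directrix API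
(`Literature.RingTheory.MvPolynomial.Directs` / `directrixSpace` / `directrixDim`, CJS Lemma 2.7 / Def. 2.8): if a subspace
`T ⊆ S_1` of linear forms directs `I ⊆ S = K[X_1, …, X_n]` (i.e. `I` is generated by polynomials in `K[T]`) and
`θ : S → S' = K[Y_1, …, Y_m]` is a `K`-algebra map sending linear forms to linear forms, then `θ(T)` directs the pushed-forward
ideal `I·S' = θ(I)S'`; hence `dim 𝒯(θ(I)S') ≤ dim 𝒯(I)` and **`e(S/I) ≤ e(S'/θ(I)S') + (n − m)`**. The instance used downstream
(`…CampaignW42HypersurfaceSectionEquality`): the substitution `X_0 ↦ 0, X_{i+1} ↦ Y_i` («restriction to the hyperplane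
`X_0 = 0`», the `K`-algebra map `aeval (Fin.cons 0 X)`; lemma names `killFirst_…`), for which `e(S/I) ≤ e(S'/I|_{X_0=0}) + 1` — Dietel's Lemma (6.4.6) read for the
directrix over an arbitrary field (his statement is for the ridge; over a perfect field the two agree, tree
`radical_ridgeIdeal_coneIdeal_eq_and_ridgeDim_eq`). Also: the substitution commutes with extension of the coefficient field. No definitions are introduced.

NOTHING here is a statement of H. Hironaka's manuscript [Hironaka2017]. AI review is weaker than expert review.
References (orientation only): B. Dietel, *A refinement of Hironaka's additive group schemes for an extended invariant*,
Dissertation Regensburg (2015), Lemma (6.4.6) p. 81; V. Cossart, U. Jannsen, S. Saito, LNM 2270 (2020), Lemma 2.7, Def. 2.8.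
-/

noncomputable section

-- single-conjunct summit: the doubled namespace component `ResolutionOfSingularities` is mandated
set_option linter.dupNamespace false

open MvPolynomial Literature.RingTheory.MvPolynomial

namespace Summit.ResolutionOfSingularities.ResolutionOfSingularities.Theorems

namespace CampaignW42

universe u

/-! ## The substitution `X_0 ↦ 0` (any commutative coefficient ring) -/

section Kill

variable (R : Type u) [CommRing R]

/-- `X_0 ↦ 0`. [folklore] -/
@[simp] theorem killFirst_X_zero (e : ℕ) : (aeval (Fin.cons 0 X : Fin (e + 1) → MvPolynomial (Fin e) R) :
      MvPolynomial (Fin (e + 1)) R →ₐ[R] MvPolynomial (Fin e) R) (X 0) = 0 := by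
  rw [aeval_X, Fin.cons_zero]

/-- `X_{i+1} ↦ Y_i`. [folklore] -/
@[simp] theorem killFirst_X_succ {e : ℕ} (i : Fin e) : (aeval (Fin.cons 0 X : Fin (e + 1) → MvPolynomial (Fin e) R) :
      MvPolynomial (Fin (e + 1)) R →ₐ[R] MvPolynomial (Fin e) R) (X i.succ) = X i := by
  rw [aeval_X, Fin.cons_succ]

/-- Constants are fixed. [folklore] -/
@[simp] theorem killFirst_C (e : ℕ) (c : R) : (aeval (Fin.cons 0 X : Fin (e + 1) → MvPolynomial (Fin e) R) :
      MvPolynomial (Fin (e + 1)) R →ₐ[R] MvPolynomial (Fin e) R) (C c) = C c :=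
  AlgHom.commutes _ c

variable {R}

/-- `killFirst ∘ rename succ = id`: `R[Y] → R[X_0, X]`, `Y_i ↦ X_{i+1}`, is a section. [folklore] -/
theorem killFirst_rename_succ {e : ℕ} (g : MvPolynomial (Fin e) R) : (aeval (Fin.cons 0 X : Fin (e + 1) → MvPolynomial (Fin e) R) :
      MvPolynomial (Fin (e + 1)) R →ₐ[R] MvPolynomial (Fin e) R) (rename Fin.succ g) = g := by
  induction g using MvPolynomial.induction_on with
  | C c => rw [rename_C, killFirst_C]
  | add p q hp hq => rw [map_add, map_add, hp, hq]
  | mul_X p i hp => rw [map_mul, map_mul, rename_X, killFirst_X_succ, hp]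

variable (R) in
/-- `killFirst` is surjective. [folklore] -/
theorem killFirst_surjective (e : ℕ) : Function.Surjective ((aeval (Fin.cons 0 X : Fin (e + 1) → MvPolynomial (Fin e) R) :
      MvPolynomial (Fin (e + 1)) R →ₐ[R] MvPolynomial (Fin e) R)) :=
  fun g => ⟨rename Fin.succ g, killFirst_rename_succ g⟩

/-- `killFirst` preserves homogeneity (of any degree; the images of the variables are linear forms or `0`). [folklore] -/
theorem isHomogeneous_killFirst {e : ℕ} {f : MvPolynomial (Fin (e + 1)) R} {d : ℕ} (hf : f.IsHomogeneous d) :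
    ((aeval (Fin.cons 0 X : Fin (e + 1) → MvPolynomial (Fin e) R) :
      MvPolynomial (Fin (e + 1)) R →ₐ[R] MvPolynomial (Fin e) R) f).IsHomogeneous d := by
  have h := hf.aeval (Fin.cons 0 X : Fin (e + 1) → MvPolynomial (Fin e) R) (n := 1) (fun i => by
    refine Fin.cases ?_ (fun j => ?_) i
    · rw [Fin.cons_zero]; exact isHomogeneous_zero _ _ _
    · rw [Fin.cons_succ]; exact isHomogeneous_X R j)
  rwa [one_mul] at h

/-- `killFirst` commutes with a change of the coefficient ring. [folklore] -/
theorem map_comp_killFirst {S : Type*} [CommRing S] (ι : R →+* S) (e : ℕ) :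
    (MvPolynomial.map ι).comp ((aeval (Fin.cons 0 X : Fin (e + 1) → MvPolynomial (Fin e) R) :
      MvPolynomial (Fin (e + 1)) R →ₐ[R] MvPolynomial (Fin e) R) : MvPolynomial (Fin (e + 1)) R →+* MvPolynomial (Fin e) R) =
      ((aeval (Fin.cons 0 X : Fin (e + 1) → MvPolynomial (Fin e) S) :
      MvPolynomial (Fin (e + 1)) S →ₐ[S] MvPolynomial (Fin e) S) : MvPolynomial (Fin (e + 1)) S →+* MvPolynomial (Fin e) S).comp (MvPolynomial.map ι) := by
  refine ringHom_ext (fun c => ?_) (fun i => ?_)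
  · rw [RingHom.comp_apply, RingHom.comp_apply, map_C]
    change MvPolynomial.map ι ((aeval (Fin.cons 0 X : Fin (e + 1) → MvPolynomial (Fin e) R) :
      MvPolynomial (Fin (e + 1)) R →ₐ[R] MvPolynomial (Fin e) R) (C c)) = (aeval (Fin.cons 0 X : Fin (e + 1) → MvPolynomial (Fin e) S) :
      MvPolynomial (Fin (e + 1)) S →ₐ[S] MvPolynomial (Fin e) S) (C (ι c))
    rw [killFirst_C, map_C, killFirst_C]
  · rw [RingHom.comp_apply, RingHom.comp_apply, map_X]
    change MvPolynomial.map ι ((aeval (Fin.cons 0 X : Fin (e + 1) → MvPolynomial (Fin e) R) :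
      MvPolynomial (Fin (e + 1)) R →ₐ[R] MvPolynomial (Fin e) R) (X i)) = (aeval (Fin.cons 0 X : Fin (e + 1) → MvPolynomial (Fin e) S) :
      MvPolynomial (Fin (e + 1)) S →ₐ[S] MvPolynomial (Fin e) S) (X i)
    refine Fin.cases ?_ (fun j => ?_) i
    · rw [killFirst_X_zero, map_zero, killFirst_X_zero]
    · rw [killFirst_X_succ, map_X, killFirst_X_succ]

/-- `killFirst` commutes with `rename succ` followed by a change of coefficients: `killFirst (map ι (rename succ g)) = map ι g`.
[folklore] -/
theorem killFirst_map_rename_succ {S : Type*} [CommRing S] (ι : R →+* S) {e : ℕ} (g : MvPolynomial (Fin e) R) :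
    (aeval (Fin.cons 0 X : Fin (e + 1) → MvPolynomial (Fin e) S) :
      MvPolynomial (Fin (e + 1)) S →ₐ[S] MvPolynomial (Fin e) S) (MvPolynomial.map ι (rename Fin.succ g)) = MvPolynomial.map ι g := by
  rw [map_rename, killFirst_rename_succ]

end Kill

variable {K : Type u} [Field K] {n m : ℕ}

/-! ## Directing subspaces push forward along graded substitutions -/

/-- **Directing subspaces push forward**: if `T` directs `I ⊆ K[X_1, …, X_n]` and the `K`-algebra map
`θ : K[X] → K[Y_1, …, Y_m]` sends linear forms to linear forms, then `θ(T)` directs `θ(I)·K[Y]` (the generators of `I` in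
`K[T]` map to generators of `θ(I)K[Y]` in `K[θ(T)]`). [cite: Dietel2015, Lemma (6.4.6) p. 81] -/
theorem Directs.map_of_linear (θ : MvPolynomial (Fin n) K →ₐ[K] MvPolynomial (Fin m) K)
    (hθ : ∀ f : MvPolynomial (Fin n) K, f.IsHomogeneous 1 → (θ f).IsHomogeneous 1)
    {I : Ideal (MvPolynomial (Fin n) K)} {T : Submodule K (MvPolynomial (Fin n) K)} (h : Directs I T) :
    Directs (I.map (θ : MvPolynomial (Fin n) K →+* MvPolynomial (Fin m) K)) (T.map θ.toLinearMap) := by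
  refine ⟨?_, ?_⟩
  · rintro _ ⟨t, ht, rfl⟩
    exact (mem_homogeneousSubmodule _ _).mpr (hθ t ((mem_homogeneousSubmodule _ _).mp (h.1 ht)))
  · rw [Ideal.map, Ideal.span_le]
    rintro _ ⟨g, hg, rfl⟩
    have hg' := h.2 hg
    rw [SetLike.mem_coe, ← Ideal.mem_comap]
    refine (Ideal.span_le (I := Ideal.comap (θ : MvPolynomial (Fin n) K →+* MvPolynomial (Fin m) K) _)).mpr ?_ hg'
    rintro f ⟨hfI, hfT⟩
    rw [SetLike.mem_coe, Ideal.mem_comap]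
    refine Ideal.subset_span ⟨Ideal.mem_map_of_mem _ hfI, ?_⟩
    rw [SetLike.mem_coe, Submodule.map_coe, AlgHom.coe_toLinearMap, Algebra.adjoin_image]
    exact Subalgebra.mem_map.mpr ⟨f, hfT, rfl⟩

/-- **`dim_K 𝒯(θ(I)K[Y]) ≤ dim_K 𝒯(I)`** for a graded substitution `θ`. [cite: Dietel2015, Lemma (6.4.6) p. 81] -/
theorem finrank_directrixSpace_map_le_of_linear (θ : MvPolynomial (Fin n) K →ₐ[K] MvPolynomial (Fin m) K)
    (hθ : ∀ f : MvPolynomial (Fin n) K, f.IsHomogeneous 1 → (θ f).IsHomogeneous 1)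
    (I : Ideal (MvPolynomial (Fin n) K)) :
    Module.finrank K (directrixSpace (I.map (θ : MvPolynomial (Fin n) K →+* MvPolynomial (Fin m) K))) ≤
      Module.finrank K (directrixSpace I) := by
  have hd := Directs.map_of_linear θ hθ (directs_directrixSpace I)
  haveI : FiniteDimensional K (directrixSpace I) := Submodule.finiteDimensional_of_le (directrixSpace_le_one I)
  calc Module.finrank K (directrixSpace (I.map (θ : MvPolynomial (Fin n) K →+* MvPolynomial (Fin m) K)))
      ≤ Module.finrank K ((directrixSpace I).map θ.toLinearMap) := Submodule.finrank_mono (directrixSpace_le hd)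
    _ ≤ Module.finrank K (directrixSpace I) := Submodule.finrank_map_le _ _

/-- **`e(K[X_1..X_n]/I) ≤ e(K[Y_1..Y_m]/θ(I)) + (n − m)`** for a graded substitution `θ` with `m ≤ n`: pushing forward
along a linear section of codimension `n − m` costs at most `n − m` directrix dimensions.
[cite: Dietel2015, Lemma (6.4.6) p. 81] -/
theorem directrixDim_le_directrixDim_map_add_of_linear (θ : MvPolynomial (Fin n) K →ₐ[K] MvPolynomial (Fin m) K)
    (hθ : ∀ f : MvPolynomial (Fin n) K, f.IsHomogeneous 1 → (θ f).IsHomogeneous 1) (hmn : m ≤ n)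
    (I : Ideal (MvPolynomial (Fin n) K)) :
    directrixDim I ≤ directrixDim (I.map (θ : MvPolynomial (Fin n) K →+* MvPolynomial (Fin m) K)) + (n - m) := by
  have h1 := finrank_directrixSpace_map_le_of_linear θ hθ I
  have h2 := finrank_directrixSpace_le (I := I.map (θ : MvPolynomial (Fin n) K →+* MvPolynomial (Fin m) K))
  unfold directrixDim
  omega

/-! ## The hyperplane section `X_0 = 0`: one directrix dimension at most -/

/-- **`e(K[X_0, …, X_e]/I) ≤ e(K[X_1, …, X_e]/I|_{X_0 = 0}) + 1`**: restricting a cone to a hyperplane costs at most one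
directrix dimension. [cite: Dietel2015, Lemma (6.4.6) p. 81] -/
theorem directrixDim_le_directrixDim_map_killFirst_add_one {e : ℕ} (I : Ideal (MvPolynomial (Fin (e + 1)) K)) :
    directrixDim I ≤ directrixDim (I.map ((aeval (Fin.cons 0 X : Fin (e + 1) → MvPolynomial (Fin e) K) :
      MvPolynomial (Fin (e + 1)) K →ₐ[K] MvPolynomial (Fin e) K) : MvPolynomial (Fin (e + 1)) K →+* MvPolynomial (Fin e) K)) + 1 := by
  have h := directrixDim_le_directrixDim_map_add_of_linear ((aeval (Fin.cons 0 X : Fin (e + 1) → MvPolynomial (Fin e) K) :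
      MvPolynomial (Fin (e + 1)) K →ₐ[K] MvPolynomial (Fin e) K)) (fun f hf => isHomogeneous_killFirst hf)
    (Nat.le_succ e) I
  rwa [Nat.add_sub_cancel_left] at h

/-- **The hyperplane-section inequality after ANY extension of the coefficient field**: for `I ⊆ k[X_0, …, X_e]` and a field
map `ι : k → K`, `e((I|_{X_0=0})·K) + 1 ≥ e(I·K)`. [cite: Dietel2015, Lemma (6.4.6) p. 81] -/
theorem directrixDim_map_le_directrixDim_map_killFirst_add_one {k : Type*} [Field k] (ι : k →+* K) {e : ℕ}
    (I : Ideal (MvPolynomial (Fin (e + 1)) k)) :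
    directrixDim (I.map (MvPolynomial.map ι)) ≤
      directrixDim ((I.map ((aeval (Fin.cons 0 X : Fin (e + 1) → MvPolynomial (Fin e) k) :
      MvPolynomial (Fin (e + 1)) k →ₐ[k] MvPolynomial (Fin e) k) : MvPolynomial (Fin (e + 1)) k →+* MvPolynomial (Fin e) k)).map
        (MvPolynomial.map ι)) + 1 := by
  rw [Ideal.map_map, map_comp_killFirst, ← Ideal.map_map]
  exact directrixDim_le_directrixDim_map_killFirst_add_one _

end CampaignW42

end Summit.ResolutionOfSingularities.ResolutionOfSingularities.Theorems

end
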